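import Summits.HodgeConjecture.HodgeConjecture.Theorems.HodgeLocusCensusPlaneRank6
import HarnessLib

/-!
# HodgeLocusCensusFiveTuple641 — PROVED: the census row `fiveTuple_6_4_1`, rank [p_{i+j}([P] + [P_c])] = 36 on the Fermat quartic sixfold (cell pub-hlocus, LEAD gen 4, (T28))
HONEST FRAMING: certified instances and evidence bearing on the general Hodge conjecture; no claim.

The last @[conjecture] row of `HodgeLocusCensusSchema`, Movasati's five-tuple (6,4,1 | 36, 37): δ = [P] + [P_c] for the two coordinate
3-planes P = V(x₀−ζx₁, x₂−ζx₃, x₄−ζx₅, x₆−ζx₇), P_c = V(x₀−ζx₁, x₂−ζx₃, x₄−ζ³x₅, x₆−ζ³x₇) of X⁶₄ meeting in the LINE P¹ = {x₄ = … = x₇ = 0}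
(characters (1,1,1,1) and (1,1,3,3)); rank 36 = intdim 37 − 1 (three engines A/B/R of record; tangent-level explained by the Kloosterman CI(2,2,1,1)
degeneration, COMPONENTS.md). PROVED here as `fiveTuple_6_4_1_holds`, for every field of characteristic 0 and every primitive 8th root ζ.
MECHANISM: `standardP 6 = plane64 0 0 0 0`, `standardPc 6 1 1 = plane64 0 0 1 1`; for ζ⁴ = −1 the entry collapses to ζ^{e}(1 − ζ^{2S}),
S = (i₄+j₄) + (i₆+j₆) ∈ {0,…,4} (`entry_eq_S`), vanishing iff S ∈ {0,4}. On the 19 pair-sum-type blocks of `HodgeLocusCensusPlaneRank6` the block is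
u v − u′v′ (rank ≤ 2); on the type (2,2,0,0) (rows have i₄ = i₆ = 0, u′ = u) and on (0,0,2,2) (columns have j₄ = j₆ = 0, v′ = v) it has rank 1:
M_δ = U·V through K^{19+17} (`ivhsMatrix_fiveTuple_eq_mul`, rank ≤ 36), and the 36 × 36 minor on one / two (row, column) pairs per type, chosen with
S ∈ {1,2,3} on the diagonal and S ∈ {0,4} off it, is DIAGONAL with entries ζ^{e}(1 − ζ^{2S}) ≠ 0 (rank ≥ 36). 36 = 2·17 + 1 + 1.
-/

namespace Summit.HodgeConjecture.HodgeConjecture.HodgeLocus.Census.FiveTuple641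
open TwistCells GrSection PlaneRank6

/-- the schema's P for n = 6 is the coordinate 3-plane with twists (0,0,0,0) … -/
theorem standardP6_eq : standardP 6 = plane64 0 0 0 0 := by
  unfold standardP plane64
  congr 1
  funext e
  fin_cases e <;> rfl

/-- … and P_c (m = 1, t = 1) is the one with twists (0,0,1,1). -/
theorem standardPc6_eq : standardPc 6 1 1 = plane64 0 0 1 1 := by
  unfold standardPc plane64
  congr 1
  funext e
  fin_cases e <;> rfl

/-- closed form of an entry of M_δ for an arbitrary ζ: ζ^{e} + ζ^{e′} on 'all four pair sums of i + j equal 2', else 0. -/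
theorem entry_eq {K : Type*} [Field K] (ζ : K) (i : Fin 8 → ℕ) (hi : i ∈ indexSet 6 4 (6 / 2 * 4 - 6 - 2))
    (j : Fin 8 → ℕ) (hj : j ∈ indexSet 6 4 4) :
    ivhsMatrix 6 4 ζ [(1, plane64 0 0 0 0), (1, plane64 0 0 1 1)] ⟨i, hi⟩ ⟨j, hj⟩ =
      if i 0 + j 0 + (i 1 + j 1) = 2 ∧ i 2 + j 2 + (i 3 + j 3) = 2 ∧ i 4 + j 4 + (i 5 + j 5) = 2 ∧ i 6 + j 6 + (i 7 + j 7) = 2 then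
        ζ ^ ((i 0 + j 0 + 1) * (1 + 2 * 0) + (i 2 + j 2 + 1) * (1 + 2 * 0) + (i 4 + j 4 + 1) * (1 + 2 * 0) + (i 6 + j 6 + 1) * (1 + 2 * 0)) +
          ζ ^ ((i 0 + j 0 + 1) * (1 + 2 * 0) + (i 2 + j 2 + 1) * (1 + 2 * 0) + (i 4 + j 4 + 1) * (1 + 2 * 1) + (i 6 + j 6 + 1) * (1 + 2 * 1))
      else 0 := by
  unfold ivhsMatrix periodComb
  simp only [List.map, List.sum_cons, List.sum_nil, Rat.cast_one, one_mul, add_zero, period_plane64]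
  split_ifs <;> simp

/-- COLLAPSE for ζ⁴ = −1: the entry is ζ^{e}(1 − ζ^{2S}), S = (i₄+j₄) + (i₆+j₆). -/
theorem entry_eq_S {K : Type*} [Field K] (ζ : K) (h4 : ζ ^ 4 = -1) (i : Fin 8 → ℕ) (hi : i ∈ indexSet 6 4 (6 / 2 * 4 - 6 - 2))
    (j : Fin 8 → ℕ) (hj : j ∈ indexSet 6 4 4) :
    ivhsMatrix 6 4 ζ [(1, plane64 0 0 0 0), (1, plane64 0 0 1 1)] ⟨i, hi⟩ ⟨j, hj⟩ =
      if i 0 + j 0 + (i 1 + j 1) = 2 ∧ i 2 + j 2 + (i 3 + j 3) = 2 ∧ i 4 + j 4 + (i 5 + j 5) = 2 ∧ i 6 + j 6 + (i 7 + j 7) = 2 then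
        ζ ^ ((i 0 + j 0 + 1) * (1 + 2 * 0) + (i 2 + j 2 + 1) * (1 + 2 * 0) + (i 4 + j 4 + 1) * (1 + 2 * 0) + (i 6 + j 6 + 1) * (1 + 2 * 0)) *
          (1 - ζ ^ (2 * (i 4 + j 4 + (i 6 + j 6)))) else 0 := by
  rw [entry_eq]
  by_cases hc : i 0 + j 0 + (i 1 + j 1) = 2 ∧ i 2 + j 2 + (i 3 + j 3) = 2 ∧ i 4 + j 4 + (i 5 + j 5) = 2 ∧ i 6 + j 6 + (i 7 + j 7) = 2
  · rw [if_pos hc, if_pos hc]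
    have e : (i 0 + j 0 + 1) * (1 + 2 * 0) + (i 2 + j 2 + 1) * (1 + 2 * 0) + (i 4 + j 4 + 1) * (1 + 2 * 1) + (i 6 + j 6 + 1) * (1 + 2 * 1) =
        (i 0 + j 0 + 1) * (1 + 2 * 0) + (i 2 + j 2 + 1) * (1 + 2 * 0) + (i 4 + j 4 + 1) * (1 + 2 * 0) + (i 6 + j 6 + 1) * (1 + 2 * 0) +
          2 * (i 4 + j 4 + (i 6 + j 6)) + 4 := by ring
    rw [e, pow_add ζ _ 4, pow_add ζ _ (2 * (i 4 + j 4 + (i 6 + j 6))), h4]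
    ring
  · rw [if_neg hc, if_neg hc]

/-- the same closed form for arbitrary row/column index terms (used on the witness minor). -/
theorem entry_eq_S' {K : Type*} [Field K] (ζ : K) (h4 : ζ ^ 4 = -1) (i : indexSet 6 4 (6 / 2 * 4 - 6 - 2)) (j : indexSet 6 4 4) :
    ivhsMatrix 6 4 ζ [(1, plane64 0 0 0 0), (1, plane64 0 0 1 1)] i j =
      if i.1 0 + j.1 0 + (i.1 1 + j.1 1) = 2 ∧ i.1 2 + j.1 2 + (i.1 3 + j.1 3) = 2 ∧ i.1 4 + j.1 4 + (i.1 5 + j.1 5) = 2 ∧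
          i.1 6 + j.1 6 + (i.1 7 + j.1 7) = 2 then
        ζ ^ ((i.1 0 + j.1 0 + 1) * (1 + 2 * 0) + (i.1 2 + j.1 2 + 1) * (1 + 2 * 0) + (i.1 4 + j.1 4 + 1) * (1 + 2 * 0) +
            (i.1 6 + j.1 6 + 1) * (1 + 2 * 0)) * (1 - ζ ^ (2 * (i.1 4 + j.1 4 + (i.1 6 + j.1 6)))) else 0 :=
  entry_eq_S ζ h4 i.1 i.2 j.1 j.2

/-! ## The factorisation M_δ = U · V through K^{19} ⊕ K^{17}
Types are indexed by `PlaneRank6.sig*` (k : Fin 19); k = 18 is σ = (2,2,0,0) and k = 0 is σ = (0,0,2,2), the two rank-one blocks; the other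
seventeen types are `o k'`, k' : Fin 17. -/

/-- the seventeen non-degenerate types, as indices 1 … 17 of the type tables. -/
def o (k' : Fin 17) : Fin 19 := Fin.castSucc k'.succ

/-- `o` is injective … -/
theorem o_inj : ∀ a b : Fin 17, o a = o b → a = b := by decide
/-- … misses the two degenerate types … -/
theorem o_ne : ∀ a : Fin 17, o a ≠ 0 ∧ o a ≠ 18 := by decide
/-- … and covers every other type. -/
theorem o_cover : ∀ k : Fin 19, k = 0 ∨ k = 18 ∨ ∃ a : Fin 17, k = o a := by decide
/-- the degenerate types: σ(18) = (2,2,0,0), σ(0) = (0,0,2,2); the non-degenerate ones have 1 ≤ σ₂ + σ₃ ≤ 3. -/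
theorem sig_deg : (sig0 18 = 2 ∧ sig1 18 = 2 ∧ sig2 18 = 0 ∧ sig3 18 = 0) ∧ (sig0 0 = 0 ∧ sig1 0 = 0 ∧ sig2 0 = 2 ∧ sig3 0 = 2) ∧
    ∀ a : Fin 17, 1 ≤ sig2 (o a) + sig3 (o a) ∧ sig2 (o a) + sig3 (o a) ≤ 3 := by decide

/-- left factor U (rows × (19 + 17)): u = ζ^{i₀+i₂+i₄+i₆} on the type block (u − u′ on the block k = 0), and −u′ = −ζ^{…+2(i₄+i₆)} on the 17. -/
noncomputable def factorU {K : Type*} [Field K] (ζ : K) : Matrix (indexSet 6 4 (6 / 2 * 4 - 6 - 2)) (Fin 19 ⊕ Fin 17) K :=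
  fun i m => match m with
    | Sum.inl k => if i.1 0 + i.1 1 = sig0 k ∧ i.1 2 + i.1 3 = sig1 k ∧ i.1 4 + i.1 5 = sig2 k ∧ i.1 6 + i.1 7 = sig3 k then
        (if k = 0 then ζ ^ (i.1 0 + i.1 2 + i.1 4 + i.1 6) - ζ ^ (i.1 0 + i.1 2 + i.1 4 + i.1 6 + 2 * (i.1 4 + i.1 6))
          else ζ ^ (i.1 0 + i.1 2 + i.1 4 + i.1 6)) else 0
    | Sum.inr a => if i.1 0 + i.1 1 = sig0 (o a) ∧ i.1 2 + i.1 3 = sig1 (o a) ∧ i.1 4 + i.1 5 = sig2 (o a) ∧ i.1 6 + i.1 7 = sig3 (o a) then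
        -ζ ^ (i.1 0 + i.1 2 + i.1 4 + i.1 6 + 2 * (i.1 4 + i.1 6)) else 0

/-- right factor V ((19 + 17) × columns): v = ζ^{(j₀+1)+(j₂+1)+(j₄+1)+(j₆+1)} on the complementary type (v − v′ on the block k = 18), v′ on the 17. -/
noncomputable def factorV {K : Type*} [Field K] (ζ : K) : Matrix (Fin 19 ⊕ Fin 17) (indexSet 6 4 4) K :=
  fun m j => match m with
    | Sum.inl k => if sig0 k + (j.1 0 + j.1 1) = 2 ∧ sig1 k + (j.1 2 + j.1 3) = 2 ∧ sig2 k + (j.1 4 + j.1 5) = 2 ∧ sig3 k + (j.1 6 + j.1 7) = 2 then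
        (if k = 18 then ζ ^ ((j.1 0 + 1) + (j.1 2 + 1) + (j.1 4 + 1) + (j.1 6 + 1)) -
            ζ ^ ((j.1 0 + 1) + (j.1 2 + 1) + (j.1 4 + 1) + (j.1 6 + 1) + 2 * (j.1 4 + j.1 6))
          else ζ ^ ((j.1 0 + 1) + (j.1 2 + 1) + (j.1 4 + 1) + (j.1 6 + 1))) else 0
    | Sum.inr a => if sig0 (o a) + (j.1 0 + j.1 1) = 2 ∧ sig1 (o a) + (j.1 2 + j.1 3) = 2 ∧ sig2 (o a) + (j.1 4 + j.1 5) = 2 ∧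
        sig3 (o a) + (j.1 6 + j.1 7) = 2 then ζ ^ ((j.1 0 + 1) + (j.1 2 + 1) + (j.1 4 + 1) + (j.1 6 + 1) + 2 * (j.1 4 + j.1 6)) else 0

/-- STRUCTURE THEOREM (ζ⁴ = −1): M_{[P]+[P_c]} = U · V through K^{36}. -/
theorem ivhsMatrix_fiveTuple_eq_mul {K : Type*} [Field K] (ζ : K) (h4 : ζ ^ 4 = -1) :
    ivhsMatrix 6 4 ζ [(1, plane64 0 0 0 0), (1, plane64 0 0 1 1)] = factorU ζ * factorV ζ := by
  ext ⟨i, hi⟩ ⟨j, hj⟩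
  rw [entry_eq_S ζ h4, Matrix.mul_apply, Fintype.sum_sum_type]
  by_cases hex : ∃ k : Fin 19, i 0 + i 1 = sig0 k ∧ i 2 + i 3 = sig1 k ∧ i 4 + i 5 = sig2 k ∧ i 6 + i 7 = sig3 k
  · obtain ⟨k₀, h0, h1, h2, h3⟩ := hex
    -- the inl-sum has its only nonzero term at k₀
    rw [Finset.sum_eq_single k₀]
    rotate_left
    · intro k _ hk
      unfold factorU
      simp only
      rw [if_neg, zero_mul]
      intro h
      exact hk (sig_inj k k₀ (h.1.symm.trans h0) (h.2.1.symm.trans h1) (h.2.2.1.symm.trans h2) (h.2.2.2.symm.trans h3))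
    · intro h
      exact absurd (Finset.mem_univ k₀) h
    rcases o_cover k₀ with rfl | rfl | ⟨a₀, rfl⟩
    · -- k₀ = 0, σ = (0,0,2,2): the inr-sum vanishes, the matching columns have j₄ = j₆ = 0
      rw [Finset.sum_eq_zero (s := (Finset.univ : Finset (Fin 17)))]
      swap
      · intro a _
        unfold factorU
        simp only
        rw [if_neg, zero_mul]
        intro h
        exact (o_ne a).1 (sig_inj _ _ (h.1.symm.trans h0) (h.2.1.symm.trans h1) (h.2.2.1.symm.trans h2) (h.2.2.2.symm.trans h3))
      unfold factorU factorV
      simp only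
      rw [add_zero, if_pos (show i 0 + i 1 = sig0 0 ∧ i 2 + i 3 = sig1 0 ∧ i 4 + i 5 = sig2 0 ∧ i 6 + i 7 = sig3 0 from ⟨h0, h1, h2, h3⟩),
        if_pos trivial]
      obtain ⟨-, ⟨d0, d1, d2, d3⟩, -⟩ := sig_deg
      by_cases hc : sig0 0 + (j 0 + j 1) = 2 ∧ sig1 0 + (j 2 + j 3) = 2 ∧ sig2 0 + (j 4 + j 5) = 2 ∧ sig3 0 + (j 6 + j 7) = 2
      · obtain ⟨c0, c1, c2, c3⟩ := hc
        rw [if_pos (show sig0 0 + (j 0 + j 1) = 2 ∧ sig1 0 + (j 2 + j 3) = 2 ∧ sig2 0 + (j 4 + j 5) = 2 ∧ sig3 0 + (j 6 + j 7) = 2 from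
            ⟨c0, c1, c2, c3⟩), if_neg (show ¬ (0 : Fin 19) = 18 by decide),
          if_pos (show i 0 + j 0 + (i 1 + j 1) = 2 ∧ i 2 + j 2 + (i 3 + j 3) = 2 ∧ i 4 + j 4 + (i 5 + j 5) = 2 ∧ i 6 + j 6 + (i 7 + j 7) = 2 from
            ⟨by omega, by omega, by omega, by omega⟩)]
        rw [show j 4 = 0 by omega, show j 6 = 0 by omega]
        ring
      · rw [if_neg hc, if_neg (fun h => hc ⟨by omega, by omega, by omega, by omega⟩)]
        simp
    · -- k₀ = 18, σ = (2,2,0,0): the inr-sum vanishes, the rows have i₄ = i₆ = 0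
      rw [Finset.sum_eq_zero (s := (Finset.univ : Finset (Fin 17)))]
      swap
      · intro a _
        unfold factorU
        simp only
        rw [if_neg, zero_mul]
        intro h
        exact (o_ne a).2 (sig_inj _ _ (h.1.symm.trans h0) (h.2.1.symm.trans h1) (h.2.2.1.symm.trans h2) (h.2.2.2.symm.trans h3))
      unfold factorU factorV
      simp only
      rw [add_zero, if_pos (show i 0 + i 1 = sig0 18 ∧ i 2 + i 3 = sig1 18 ∧ i 4 + i 5 = sig2 18 ∧ i 6 + i 7 = sig3 18 from ⟨h0, h1, h2, h3⟩),
        if_neg (show ¬ (18 : Fin 19) = 0 by decide)]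
      obtain ⟨⟨d0, d1, d2, d3⟩, -, -⟩ := sig_deg
      by_cases hc : sig0 18 + (j 0 + j 1) = 2 ∧ sig1 18 + (j 2 + j 3) = 2 ∧ sig2 18 + (j 4 + j 5) = 2 ∧ sig3 18 + (j 6 + j 7) = 2
      · obtain ⟨c0, c1, c2, c3⟩ := hc
        rw [if_pos (show sig0 18 + (j 0 + j 1) = 2 ∧ sig1 18 + (j 2 + j 3) = 2 ∧ sig2 18 + (j 4 + j 5) = 2 ∧ sig3 18 + (j 6 + j 7) = 2 from
            ⟨c0, c1, c2, c3⟩), if_pos trivial,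
          if_pos (show i 0 + j 0 + (i 1 + j 1) = 2 ∧ i 2 + j 2 + (i 3 + j 3) = 2 ∧ i 4 + j 4 + (i 5 + j 5) = 2 ∧ i 6 + j 6 + (i 7 + j 7) = 2 from
            ⟨by omega, by omega, by omega, by omega⟩)]
        rw [show i 4 = 0 by omega, show i 6 = 0 by omega]
        ring
      · rw [if_neg hc, if_neg (fun h => hc ⟨by omega, by omega, by omega, by omega⟩)]
        simp
    · -- generic type o a₀: the inr-sum has its only nonzero term at a₀
      rw [Finset.sum_eq_single a₀]
      rotate_left
      · intro a _ ha
        unfold factorU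
        simp only
        rw [if_neg, zero_mul]
        intro h
        exact ha (o_inj a a₀ (sig_inj _ _ (h.1.symm.trans h0) (h.2.1.symm.trans h1) (h.2.2.1.symm.trans h2) (h.2.2.2.symm.trans h3)))
      · intro h
        exact absurd (Finset.mem_univ a₀) h
      unfold factorU factorV
      simp only
      rw [if_pos (show i 0 + i 1 = sig0 (o a₀) ∧ i 2 + i 3 = sig1 (o a₀) ∧ i 4 + i 5 = sig2 (o a₀) ∧ i 6 + i 7 = sig3 (o a₀) from
          ⟨h0, h1, h2, h3⟩), if_neg (o_ne a₀).1,
        if_pos (show i 0 + i 1 = sig0 (o a₀) ∧ i 2 + i 3 = sig1 (o a₀) ∧ i 4 + i 5 = sig2 (o a₀) ∧ i 6 + i 7 = sig3 (o a₀) from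
          ⟨h0, h1, h2, h3⟩)]
      by_cases hc : sig0 (o a₀) + (j 0 + j 1) = 2 ∧ sig1 (o a₀) + (j 2 + j 3) = 2 ∧ sig2 (o a₀) + (j 4 + j 5) = 2 ∧ sig3 (o a₀) + (j 6 + j 7) = 2
      · obtain ⟨c0, c1, c2, c3⟩ := hc
        rw [if_pos (show sig0 (o a₀) + (j 0 + j 1) = 2 ∧ sig1 (o a₀) + (j 2 + j 3) = 2 ∧ sig2 (o a₀) + (j 4 + j 5) = 2 ∧
            sig3 (o a₀) + (j 6 + j 7) = 2 from ⟨c0, c1, c2, c3⟩), if_neg (o_ne a₀).2,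
          if_pos (show sig0 (o a₀) + (j 0 + j 1) = 2 ∧ sig1 (o a₀) + (j 2 + j 3) = 2 ∧ sig2 (o a₀) + (j 4 + j 5) = 2 ∧
            sig3 (o a₀) + (j 6 + j 7) = 2 from ⟨c0, c1, c2, c3⟩),
          if_pos (show i 0 + j 0 + (i 1 + j 1) = 2 ∧ i 2 + j 2 + (i 3 + j 3) = 2 ∧ i 4 + j 4 + (i 5 + j 5) = 2 ∧ i 6 + j 6 + (i 7 + j 7) = 2 from
            ⟨by omega, by omega, by omega, by omega⟩)]
        ring
      · rw [if_neg hc, if_neg hc, if_neg (fun h => hc ⟨by omega, by omega, by omega, by omega⟩)]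
        simp
  · -- a row of a type with some pair sum > 2: both sides vanish
    have hU : ∀ m, factorU ζ ⟨i, hi⟩ m = 0 := fun m => by
      unfold factorU
      rcases m with k | a
      · exact if_neg (fun h => hex ⟨k, h⟩)
      · exact if_neg (fun h => hex ⟨o a, h⟩)
    rw [Finset.sum_eq_zero (fun k _ => by rw [hU, zero_mul]), Finset.sum_eq_zero (fun a _ => by rw [hU, zero_mul]), add_zero, if_neg]
    intro hc
    obtain ⟨c0, c1, c2, c3⟩ := hc
    exact hex (sig_cover' (i 0 + i 1) (i 2 + i 3) (i 4 + i 5) (i 6 + i 7) (by omega) (by omega) (by omega) (by omega)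
      (by have h := (Finset.mem_filter.mp hi).2; rw [Fin.sum_univ_eight] at h; omega))

/-- UPPER BOUND: rank ≤ 36 = 19 + 17 for ζ⁴ = −1. -/
theorem rank_le_thirtysix {K : Type*} [Field K] (ζ : K) (h4 : ζ ^ 4 = -1) :
    (ivhsMatrix 6 4 ζ [(1, plane64 0 0 0 0), (1, plane64 0 0 1 1)]).rank ≤ 36 := by
  rw [ivhsMatrix_fiveTuple_eq_mul ζ h4]
  exact (Matrix.rank_mul_le_left _ _).trans (by simpa using Matrix.rank_le_card_width (factorU ζ))

/-! ## The 36 × 36 diagonal witness minor -/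

/-- the special row / column x₄x₅x₆² (type (0,0,2,2), i₄ + i₆ = 3) … -/
theorem special_mem_rows : (![0, 0, 0, 0, 1, 1, 2, 0] : Fin 8 → ℕ) ∈ indexSet 6 4 (6 / 2 * 4 - 6 - 2) := by
  unfold indexSet
  simp only [Finset.mem_filter, Fintype.mem_piFinset, Finset.mem_range, Fin.forall_fin_succ, Fin.sum_univ_succ]
  simp

/-- … also as a column. -/
theorem special_mem_cols : (![0, 0, 0, 0, 1, 1, 2, 0] : Fin 8 → ℕ) ∈ indexSet 6 4 4 := by
  unfold indexSet
  simp only [Finset.mem_filter, Fintype.mem_piFinset, Finset.mem_range, Fin.forall_fin_succ, Fin.sum_univ_succ]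
  simp

/-- the rows x^{(σ₀,0,σ₁,0,0,σ₂,0,σ₃)} (i₄ + i₆ = 0) lie in I₄ … -/
theorem rowPick0_mem (k : Fin 19) : (![sig0 k, 0, sig1 k, 0, 0, sig2 k, 0, sig3 k] : Fin 8 → ℕ) ∈ indexSet 6 4 (6 / 2 * 4 - 6 - 2) := by
  obtain ⟨l0, l1, l2, l3⟩ := sig_le k
  have hs := sig_sum k
  unfold indexSet
  simp only [Finset.mem_filter, Fintype.mem_piFinset, Finset.mem_range, Fin.forall_fin_succ, Fin.sum_univ_succ]
  simp
  omega

/-- … and so do the columns x^{(2−σ₀,0,2−σ₁,0,0,2−σ₂,0,2−σ₃)} (j₄ + j₆ = 0). -/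
theorem colPick0_mem (k : Fin 19) : (![2 - sig0 k, 0, 2 - sig1 k, 0, 0, 2 - sig2 k, 0, 2 - sig3 k] : Fin 8 → ℕ) ∈ indexSet 6 4 4 := by
  obtain ⟨l0, l1, l2, l3⟩ := sig_le k
  have hs := sig_sum k
  unfold indexSet
  simp only [Finset.mem_filter, Fintype.mem_piFinset, Finset.mem_range, Fin.forall_fin_succ, Fin.sum_univ_succ]
  simp
  omega

/-- witness rows: per type the row with i₄ + i₆ = σ₂ + σ₃ (`PlaneRank6.rowPick`; for k = 0 the special row, i₄ + i₆ = 3), and per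
non-degenerate type additionally the row with i₄ + i₆ = 0. -/
def r : Fin 19 ⊕ Fin 17 → indexSet 6 4 (6 / 2 * 4 - 6 - 2)
  | Sum.inl k => if k = 0 then ⟨![0, 0, 0, 0, 1, 1, 2, 0], special_mem_rows⟩ else rowPick k
  | Sum.inr a => ⟨![sig0 (o a), 0, sig1 (o a), 0, 0, sig2 (o a), 0, sig3 (o a)], rowPick0_mem (o a)⟩

/-- witness columns (complementary type): j₄ + j₆ = 0 (for k = 18 the special column, j₄ + j₆ = 3), resp. j₄ + j₆ = 4 − σ₂ − σ₃ (`PlaneRank6.colPick`). -/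
def c : Fin 19 ⊕ Fin 17 → indexSet 6 4 4
  | Sum.inl k => if k = 18 then ⟨![0, 0, 0, 0, 1, 1, 2, 0], special_mem_cols⟩
      else ⟨![2 - sig0 k, 0, 2 - sig1 k, 0, 0, 2 - sig2 k, 0, 2 - sig3 k], colPick0_mem k⟩
  | Sum.inr a => colPick (o a)

/-- the type of a witness index. -/
def typ : Fin 19 ⊕ Fin 17 → Fin 19
  | Sum.inl k => k
  | Sum.inr a => o a

/-- pair sums of the witness rows = their type … -/
theorem r_sums : ∀ p : Fin 19 ⊕ Fin 17, (r p).1 0 + (r p).1 1 = sig0 (typ p) ∧ (r p).1 2 + (r p).1 3 = sig1 (typ p) ∧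
    (r p).1 4 + (r p).1 5 = sig2 (typ p) ∧ (r p).1 6 + (r p).1 7 = sig3 (typ p) := by decide

/-- … the witness columns have the complementary type … -/
theorem c_sums : ∀ q : Fin 19 ⊕ Fin 17, sig0 (typ q) + ((c q).1 0 + (c q).1 1) = 2 ∧ sig1 (typ q) + ((c q).1 2 + (c q).1 3) = 2 ∧
    sig2 (typ q) + ((c q).1 4 + (c q).1 5) = 2 ∧ sig3 (typ q) + ((c q).1 6 + (c q).1 7) = 2 := by decide

/-- … on the diagonal S = (i₄+j₄) + (i₆+j₆) ∈ {1,2,3} … -/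
theorem diag_S : ∀ p : Fin 19 ⊕ Fin 17, 1 ≤ (r p).1 4 + (c p).1 4 + ((r p).1 6 + (c p).1 6) ∧
    (r p).1 4 + (c p).1 4 + ((r p).1 6 + (c p).1 6) ≤ 3 := by decide

/-- … and off the diagonal, within a type, S ∈ {0, 4}. -/
theorem offdiag_S : ∀ p q : Fin 19 ⊕ Fin 17, p ≠ q → typ p = typ q →
    (r p).1 4 + (c q).1 4 + ((r p).1 6 + (c q).1 6) = 0 ∨ (r p).1 4 + (c q).1 4 + ((r p).1 6 + (c q).1 6) = 4 := by decide

/-- the witness minor is diagonal (ζ a primitive 8th root) … -/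
theorem minor_offdiag {K : Type*} [Field K] (ζ : K) (hζ : IsPrimitiveRoot ζ (2 * 4)) (p q : Fin 19 ⊕ Fin 17) (hpq : p ≠ q) :
    ivhsMatrix 6 4 ζ [(1, plane64 0 0 0 0), (1, plane64 0 0 1 1)] (r p) (c q) = 0 := by
  have h4 : ζ ^ 4 = -1 := zeta_pow_four_of_primitive hζ
  have h8 : ζ ^ 8 = 1 := hζ.pow_eq_one
  rw [entry_eq_S' ζ h4]
  by_cases ht : typ p = typ q
  · rcases offdiag_S p q hpq ht with hS | hS <;> rw [hS] <;> norm_num [h8]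
  · rw [if_neg]
    intro hc
    obtain ⟨c0, c1, c2, c3⟩ := hc
    obtain ⟨r0, r1, r2, r3⟩ := r_sums p
    obtain ⟨q0, q1, q2, q3⟩ := c_sums q
    exact ht (sig_inj _ _ (by omega) (by omega) (by omega) (by omega))

/-- … with diagonal entries ζ^{e}(1 − ζ^{2S}), S ∈ {1,2,3}, nonzero. -/
theorem minor_diag {K : Type*} [Field K] (ζ : K) (hζ : IsPrimitiveRoot ζ (2 * 4)) (p : Fin 19 ⊕ Fin 17) :
    ivhsMatrix 6 4 ζ [(1, plane64 0 0 0 0), (1, plane64 0 0 1 1)] (r p) (c p) ≠ 0 := by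
  have h4 : ζ ^ 4 = -1 := zeta_pow_four_of_primitive hζ
  have hz : ζ ≠ 0 := hζ.ne_zero (by norm_num)
  rw [entry_eq_S' ζ h4]
  obtain ⟨r0, r1, r2, r3⟩ := r_sums p
  obtain ⟨q0, q1, q2, q3⟩ := c_sums p
  obtain ⟨s1, s3⟩ := diag_S p
  rw [if_pos ⟨by omega, by omega, by omega, by omega⟩]
  exact mul_ne_zero (pow_ne_zero _ hz) (sub_ne_zero.mpr (hζ.pow_ne_one_of_pos_of_lt (by omega) (by omega)).symm)

/-- LOWER BOUND: 36 ≤ rank (the diagonal witness minor is a unit). -/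
theorem thirtysix_le_rank {K : Type*} [Field K] (ζ : K) (hζ : IsPrimitiveRoot ζ (2 * 4)) :
    36 ≤ (ivhsMatrix 6 4 ζ [(1, plane64 0 0 0 0), (1, plane64 0 0 1 1)]).rank := by
  classical
  set M := ivhsMatrix 6 4 ζ [(1, plane64 0 0 0 0), (1, plane64 0 0 1 1)] with hM
  have hS : M.submatrix r c = Matrix.diagonal (fun p => M (r p) (c p)) := by
    ext p q
    by_cases hpq : p = q
    · subst hpq
      rw [Matrix.diagonal_apply_eq, Matrix.submatrix_apply]
    · rw [Matrix.diagonal_apply_ne _ hpq, Matrix.submatrix_apply]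
      exact minor_offdiag ζ hζ p q hpq
  have hdet : IsUnit (M.submatrix r c).det := by
    rw [hS, Matrix.det_diagonal]
    exact isUnit_iff_ne_zero.mpr (Finset.prod_ne_zero_iff.mpr fun p _ => minor_diag ζ hζ p)
  have hrank : (M.submatrix r c).rank = 36 := by
    rw [Matrix.rank_of_isUnit _ ((Matrix.isUnit_iff_isUnit_det _).mpr hdet), Fintype.card_sum, Fintype.card_fin, Fintype.card_fin]
  calc 36 = (M.submatrix r c).rank := hrank.symm
    _ ≤ M.rank := Matrix.rank_submatrix_le M r c

/-- PROVED ROW: rank [p_{i+j}([P] + [P_c])] = 36 for the two 3-planes of X⁶₄ meeting in a line. -/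
theorem ivhsRankEq_fiveTuple641 : IvhsRankEq 6 4 36 [(1, plane64 0 0 0 0), (1, plane64 0 0 1 1)] := by
  intro K _ _ ζ hζ
  exact le_antisymm (rank_le_thirtysix ζ (zeta_pow_four_of_primitive hζ)) (thirtysix_le_rank ζ hζ)

/-- the census row `fiveTuple_6_4_1` of the schema HOLDS. -/
theorem fiveTuple_6_4_1_holds : fiveTuple_6_4_1 := by
  unfold fiveTuple_6_4_1
  rw [standardP6_eq, standardPc6_eq]
  exact ivhsRankEq_fiveTuple641

/-- the count 36 = 2·17 + 1 + 1 = intdim 37 − 1 (37 = 2·19 − 1 = codim NL(P) + codim NL(P_c) − [line correction]). -/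
theorem thirtysix_count : 2 * 17 + 1 + 1 = 36 ∧ 19 + 17 = 36 ∧ 37 - 1 = 36 := by decide

end Summit.HodgeConjecture.HodgeConjecture.HodgeLocus.Census.FiveTuple641
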